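import Summits.QuantumFields.GaugeBoot.Rows.GLYZc2D4YCol
import Summits.QuantumFields.GaugeBoot.Rows.GLYZc2D4HTab
import Summits.QuantumFields.GaugeBoot.Rows.GLYZc2D4STab
import Summits.QuantumFields.GaugeBoot.Rows.GLYZc2D4LTab
import Summits.QuantumFields.GaugeBoot.Rows.RedEnc
import HarnessLib

/-!
# Gauge-boot: kernel check of the REDUCTION IDENTITY of the glyz-c2-4D problems, blocks 9 (part 22/34)

Cell `pub-gaugeboot` (HOME `run/shared/lean/pub/pub-gaugeboot/`), seat lean1 (torus layer for rows C76–C87 = the certified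
glyz-c2-4D windows: label set, raw blocks, class/witness tables, the reduction identity, per-β bindings).

HONEST FRAMING (page 1 of every file of this cell): certified bounds on lattice expectations at STATED coupling,
gauge group, dimension and torus size; NOT a mass gap, NOT a continuum limit, NOT a string tension, NOT large `N`.
The venture is explicitly NOT Yang–Mills-summit-bearing (barriers `FixedCouplingUltralocality`,
`PerturbativeInvisibility`).

For each listed block `k` and `i ≤ j < bdim k` in the stated rectangles: the expansion of `(Y_k)ᵢᵀ · cls · (Y_k)ⱼ` over the raw
class table of the block's family (`hcls` / `scls` / `lcls`) EQUALS, as an integer linear form in the 4480 variables, lean3's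
transcription `Certificates.N2c2D4.ent k i j` of the problem files' entry — checked through the radix-`2^20` encoding `RedEnc.encCheck`
(one big-integer identity per entry, `decide +kernel` on index rectangles of ≤ 12000 expansion terms); assemblies `red_ok_k`
(`i ≤ j`) + range facts `ycol_lt_k` sit with a block's last rectangle, or in `GLYZc2D4RedAsm` when a block spans parts.  Consumed by `GLYZc2D4Red`.
-/

set_option Elab.async false

noncomputable section

open Literature.MathematicalPhysics.QuantumFieldTheory

namespace Summit.QuantumFields.GaugeBoot

namespace GLYZc2D4

set_option maxHeartbeats 0 in
/-- Reduction identity (glyz-c2-4D), block 9, rows `19 ≤ i < 22`, columns `max i 0 ≤ j < 22` (8208 expansion terms; kernel). -/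
theorem red_ok_9_40 : ∀ i j : Fin 22, 19 ≤ i.val → i.val < 22 → 0 ≤ j.val → j.val < 22 → i.val ≤ j.val →
    RedEnc.encCheck 20 4480 (GLYZc2D4.ycol 9 i) (GLYZc2D4.ycol 9 j) (fun a b => (GLYZc2D4.hcls a b).val) (Certificates.N2c2D4.ent 9 i j) = true := by
  decide +kernel

end GLYZc2D4

end Summit.QuantumFields.GaugeBoot

end
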